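import Summits.Ventures.CertifiedArithmetic.Expansions.EstimateErrorBoundWeak

/-!
# `|estimate − Σ| ≤ (5/2)·u·|Σ|` on weakly nonoverlapping expansions — the sharp constant

NEW WORK in the sense of this development (routine and expansion class are Shewchuk's; theorem
and proof are ours).  `EstimateWeakExpansion.lean` showed that `predicates.c`'s `estimate` (the
floating-point sum of the components, smallest first) has the SIGN of the true sum on every
weakly nonoverlapping expansion of floats (`IsWeakExpansion`: the class `W` preserved by the
expansion algorithms under ties-to-even), for `p ≥ 2` and any round-to-nearest.  THIS FILE
proves the quantitative statement behind it, with the best possible constant: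
* `abs_estimate_sub_sum_le_sharp_of_isWeakExpansion` — **`|estimate l − Σ l| ≤ (5/2)·u·|Σ l|`**
  (`u = 2^−p`; `p ≥ 2`, any `IsRoundNearest p emin fl`, any length, zeros allowed), whence the
  rounder
* `abs_estimate_sub_sum_le_of_isWeakExpansion` — `|estimate l − Σ l| ≤ 3u·|Σ l|` (the form the
  stage-B/C files of this directory consume) and
* `abs_estimate_bounds_of_isWeakExpansion` — `(1 − 3u)·|Σ| ≤ |estimate| ≤ (1 + 3u)·|Σ|`.
SHARPNESS: `EstimateUlpCounterexample.lean` exhibits, for every `p ≥ 4` (ties-to-even), a `W`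
expansion with ratio `|estimate − Σ|/(u|Σ|) = 5/(2 + 5u) → 5/2`; no constant below `5/2` holds
for all precisions.  For a merely nonoverlapping expansion no relative bound holds at all
(`Orient2dEstimate`: `⟨15/16, 15, −16⟩`, `p = 4`, has `estimate = 0 ≠ Σ`).  The in-tree bound for
the 4-component block of `orient2dadapt` (`Orient2dDetBApprox`: `(ε + 4ε²)|det| + (ε² + 3ε³)s`,
`p ≥ 4`) is of the mixed absolute/relative kind of Shewchuk's error analysis; the present one is
purely relative and uniform in the length, which is what a stage-B style test on a `W` expansion
(e.g. `fin1` of ORIENT3D / INCIRCLE) needs.  What `5/2` buys for Shewchuk's PRINTED stage-C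
coefficient: its margin holds for every `p ≥ 5` (`StageBMarginsAttained`, `Orient3dStageCCorrect`).

PROOF.  Write `l = l' ++ [a]` with `a = M·2^v`, `M` odd (zeros are transparent), and
`Q = estimate l'`; the components of `l'` lie below `2^v`, so `|Q − Σ l'| ≤ u·2^v`
(`EstimateErrorBound`).  If `|M| ≥ 2`, or if `a = ±2^v` and all of `l'` lies below `2^(v−1)`,
then `|Σ| ≥ 2^t` for `t = v` resp. `v − 1` and the step lemma gives `(2 + u)u·|Σ|`.  Otherwise
(`W`) `l' = l₁ ++ [x₀] ++ zeros` with `|x₀| = 2^(v−1)` and `l₁` (a `W` list) below `2^(v−2)`;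
put `Q₁ = estimate l₁`, `T = Q₁ + x₀`, `Q = fl T`, `R = Q + a`.
Same signs (`a = 2x₀`): `|Σ| ≥ 5·2^(v−2) ≥ 2^v`, step lemma.  Opposite signs (`a = −2x₀`,
`|Σ| ≥ 2^(v−1) − |Σ l₁|`): if `|T| ≤ 2^(v−1)` then `|Q − T| ≤ (u/2)·2^(v−1)`, `|R| ≤ 2^v`,
`|fl R − R| ≤ (u/2)·2^v`, `|Q₁ − Σ l₁| ≤ u·2^(v−2)`, total `≤ 4u·2^(v−2)` — but then `Q₁` has the
sign of `a` and `|Σ| ≥ 2^(v−1) − u·2^(v−2)`; if `|T| > 2^(v−1)` then `2^(v−1) ≤ |Q| ≤ 2^v`,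
`|R| < 2^v` and `R` is a FLOAT (exact last addition), so the error is `(Q − T) + (Q₁ − Σ l₁)` with
`|Q − T| ≤ (u/2)·2^v = 2u·2^(v−2)` and — the decisive input — the COUPLED invariant of
`EstimateErrorBoundWeak`, `|Q₁ − Σ l₁| ≤ 3u·2^(v−2) − (5/2)u·|Σ l₁|`: total
`(5/2)·u·(2^(v−1) − |Σ l₁|) ≤ (5/2)·u·|Σ|`.  This is the only place where the constant exceeds
`2 + u`, and the budget closes with zero slack — which is why the witnesses approach `5/2`.

EVIDENCE gathered before the proofs (exhaustive; components `p`-bit floats `< 2^E`, all `W`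
lists of length `≤ N`; ties-to-even, and "adversarial" ties = both directions explored at every
tie; engines drafts `estimate_ulp_search/`): the largest ratio `|estimate − Σ|/(u|Σ|)` over all
`W` lists is `2.2992, 2.4593, 2.4783` at `p = 4, 5, 6` under ties-to-even (41.6 M / 227 M / 155 M
lists; e.g. `p = 6`: `⟨−1, −90, −256, −3584, −8192, 16384⟩`, estimate `4096`, `Σ = 4261`) and
`2.4490, 2.4505, 2.4684` at `p = 3, 4, 5` (`N ≤ 6`) resp. `2.4936` at `p = 3`, `N = 8` with
adversarial ties (`⟨−1, −12, −32, −64, −256, −512, −2048, 4096⟩`, every tie toward zero):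
never `5/2`.  `p = 1` is excluded as in `EstimateWeakExpansion` (`⟨−8, −16, −64, 128⟩` has
estimate `0`, `Σ = 40`).

Reference for the routine: J. R. Shewchuk, Discrete Comput. Geom. 18 (1997) 305–363, §2.7 and
`predicates.c` (`estimate`) [Shewchuk1997].
-/

namespace Summit.Ventures.CertifiedArithmetic.Expansions

open Literature.ComputerArithmetic.JeannerodRump2018
open Literature.ComputerArithmetic.BoldoJeannerodMelquiondMuller2023 hiding twoSum twoSum_fst
  isFloat_twoSum
open Literature.ComputerArithmetic.JoldesMullerPopescu2017 (isFloat_two_zpow abs_fl_le_of_abs_le)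
open Literature.ComputerArithmetic.RumpOgitaOishi2008 (eq_zero_of_isFloat_of_abs_lt)
open Literature.ComputerArithmetic.Shewchuk1997

variable {p : ℕ} {emin : ℤ} {fl : ℚ → ℚ}

/-! ## The relative error of `estimate` on a weakly nonoverlapping expansion -/

set_option maxHeartbeats 800000 in
/-- **`|estimate − Σ| ≤ (5/2)·u·|Σ|` ON WEAKLY NONOVERLAPPING EXPANSIONS — SHARP.**  For `p ≥ 2`,
any round-to-nearest `fl` into `F(p, emin)` and any list of floats with the `W` property
(components smallest first, zeros allowed), `predicates.c`'s `estimate` is within `(5/2)u`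
RELATIVE error of the true sum (`u = 2^−p`); in particular it never returns `0` for a nonzero sum
and always has the sign of the sum (`estimate_sign_of_isWeakExpansion`).  The constant is best
possible over all precisions (`EstimateUlpCounterexample`: ratio `5/(2 + 5u)`). -/
theorem abs_estimate_sub_sum_le_sharp_of_isWeakExpansion (hp : 2 ≤ p)
    (hfl : IsRoundNearest p emin fl) :
    ∀ {l : List ℚ}, (∀ x ∈ l, IsFloat p emin x) → IsWeakExpansion l →
      |estimate fl l - l.sum| ≤ 5 / 2 * unitRoundoff p * |l.sum| := by
  have hp1 : 1 ≤ p := le_trans (by norm_num) hp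
  have hu0 : 0 ≤ unitRoundoff p := by unfold unitRoundoff; positivity
  have hu4 : unitRoundoff p ≤ 1 / 4 := by
    unfold unitRoundoff
    rw [div_le_div_iff_of_pos_left (by norm_num) (by positivity) (by norm_num)]
    calc (4 : ℚ) = 2 ^ 2 := by norm_num
      _ ≤ 2 ^ p := pow_le_pow_right₀ (by norm_num) hp
  -- the step lemma's `(2 + u)u` is below `5/2·u`
  have h238 : ∀ S : ℚ, (2 + unitRoundoff p) * unitRoundoff p * |S| ≤
      5 / 2 * unitRoundoff p * |S| := fun S =>
    mul_le_mul_of_nonneg_right (mul_le_mul_of_nonneg_right (by linarith) hu0) (abs_nonneg S)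
  intro l
  induction l using List.reverseRecOn with
  | nil => intro _ _; simp [estimate]
  | append_singleton l a ih =>
    intro hF hW
    have hFl : ∀ x ∈ l, IsFloat p emin x := fun x hx => hF x (by simp [hx])
    have hFa : IsFloat p emin a := hF a (by simp)
    have hWl : IsWeakExpansion l := hW.sublist (List.sublist_append_left l [a])
    have hEl : IsExpansion 1 l := hWl.isExpansion
    rw [List.sum_append, List.sum_singleton]
    by_cases hl : l = []
    · subst hl
      rw [show estimate fl ([] ++ [a]) = a from rfl, List.sum_nil, zero_add, sub_self, abs_zero]
      exact mul_nonneg (mul_nonneg (by norm_num) hu0) (abs_nonneg _)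
    rw [estimate_append_singleton fl hl]
    have hQF : IsFloat p emin (estimate fl l) := isFloat_estimate hfl hFl
    by_cases ha0 : a = 0
    · rw [ha0, add_zero, add_zero, fl_eq_self hfl hQF]; exact ih hFl hWl
    obtain ⟨M, v, hMo, -, hev, hav⟩ := exists_odd_mul_two_zpow hFa ha0
    have h2v : (0 : ℚ) < (2 : ℚ) ^ v := zpow_pos (by norm_num) _
    have hWa : ∀ x ∈ l, WeakBelow x a := fun x hx =>
      (List.pairwise_append.mp hW.1).2.2 x hx a (by simp)
    -- every earlier component lies below `2^v`
    have hv : ∀ x ∈ l, |x| < (2 : ℚ) ^ v := fun x hx => by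
      obtain ⟨s', hs', hxs'⟩ := (hWa x hx).below_one
      rw [one_mul] at hxs'
      rw [hav] at hs'
      exact lt_of_lt_of_le hxs' (zpow_le_zpow_right₀ (by norm_num) (OnGrid.le_of_odd hMo hs'))
    have hsum : |l.sum| < (2 : ℚ) ^ v := abs_sum_lt_two_zpow_of_isExpansion hFl hEl hv
    have hM0 : M ≠ 0 := by rintro rfl; obtain ⟨k, hk⟩ := hMo; omega
    have hM1 : (1 : ℤ) ≤ |M| := Int.one_le_abs hM0
    have habs : |a| = |(M : ℚ)| * (2 : ℚ) ^ v := by rw [hav, abs_mul, abs_of_pos h2v]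
    have htri : |a| - |l.sum| ≤ |l.sum + a| := by
      have := abs_sub_abs_le_abs_sub a (-l.sum)
      rwa [abs_neg, sub_neg_eq_add, add_comm a] at this
    by_cases hM : |M| = 1
    swap
    · -- `|M| ≥ 2`: `|a| ≥ 2·2^v`, so `|Σ| > 2^v` bounds every error relatively
      have hM2 : (2 : ℚ) ≤ |(M : ℚ)| := by
        have : (2 : ℤ) ≤ |M| := by
          have := lt_of_le_of_ne hM1 (Ne.symm hM); linarith
        rw [← Int.cast_abs]; exact_mod_cast this
      have ha2 : 2 * (2 : ℚ) ^ v ≤ |a| := by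
        rw [habs]; exact mul_le_mul_of_nonneg_right hM2 h2v.le
      exact (abs_estimate_step_le_two_add_u hp1 hfl hFl hEl hFa hv (by linarith)).trans (h238 _)
    -- `a = ± 2^v`
    have ha1 : |a| = (2 : ℚ) ^ v := by
      rw [habs, ← Int.cast_abs, hM]; push_cast; ring
    have e1 : (2 : ℚ) ^ v = 2 * (2 : ℚ) ^ (v - 1) := by
      rw [mul_comm, ← zpow_add_one₀ (by norm_num : (2 : ℚ) ≠ 0), sub_add_cancel]
    have e2 : (2 : ℚ) ^ (v - 1) = 2 * (2 : ℚ) ^ (v - 2) := by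
      rw [mul_comm, ← zpow_add_one₀ (by norm_num : (2 : ℚ) ≠ 0)]; ring_nf
    have h2v1 : (0 : ℚ) < (2 : ℚ) ^ (v - 1) := zpow_pos (by norm_num) _
    have h2v2 : (0 : ℚ) < (2 : ℚ) ^ (v - 2) := zpow_pos (by norm_num) _
    -- the others are `≤ 2^(v-1)`, and `< 2^(v-1)` unless one-bit of that size
    have hsmall : ∀ x ∈ l, |x| < (2 : ℚ) ^ (v - 1) ∨ |x| = (2 : ℚ) ^ (v - 1) := by
      intro x hx
      rcases hWa x hx with hB2 | ⟨-, e, he⟩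
      · left
        obtain ⟨s', hs', hxs'⟩ := hB2
        rw [hav] at hs'
        have : (2 : ℚ) ^ s' ≤ (2 : ℚ) ^ v :=
          zpow_le_zpow_right₀ (by norm_num) (OnGrid.le_of_odd hMo hs')
        linarith
      · have hxv := hv x hx
        rw [he] at hxv
        have hev' : e ≤ v - 1 := by
          by_contra h
          rw [not_le] at h
          have : (2 : ℚ) ^ v ≤ (2 : ℚ) ^ e := zpow_le_zpow_right₀ (by norm_num) (by omega)
          linarith
        rcases lt_or_eq_of_le hev' with hlt | heq
        · left; rw [he]; exact zpow_lt_zpow_right₀ (by norm_num) hlt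
        · right; rw [he, heq]
    by_cases hbig : ∃ x₀ ∈ l, |x₀| = (2 : ℚ) ^ (v - 1)
    swap
    · -- all others `< 2^(v-1)`: `|Σ| > 2^v − 2^(v-1) = 2^(v-1)`
      push Not at hbig
      have hv1 : ∀ x ∈ l, |x| < (2 : ℚ) ^ (v - 1) := fun x hx =>
        (hsmall x hx).resolve_right (hbig x hx)
      have hsum1 : |l.sum| < (2 : ℚ) ^ (v - 1) := abs_sum_lt_two_zpow_of_isExpansion hFl hEl hv1
      exact (abs_estimate_step_le_two_add_u hp1 hfl hFl hEl hFa hv1 (by linarith)).trans (h238 _)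
    obtain ⟨x₀, hx₀, hx₀abs⟩ := hbig
    obtain ⟨l₁, l₂, rfl⟩ := List.append_of_mem hx₀
    have hF₁ : ∀ y ∈ l₁, IsFloat p emin y := fun y hy => hFl y (by simp [hy])
    have hFx₀ : IsFloat p emin x₀ := hFl x₀ (by simp)
    have hx₀0 : x₀ ≠ 0 := by
      intro h; rw [h, abs_zero] at hx₀abs; exact absurd hx₀abs (ne_of_lt h2v1)
    have hev1 : emin ≤ v - 1 := by
      by_contra h
      exact hx₀0 (eq_zero_of_isFloat_of_abs_lt hFx₀
        (by rw [hx₀abs]; exact zpow_lt_zpow_right₀ (by norm_num) (by omega)))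
    -- after `x₀` only zeros
    have hl₂ : ∀ y ∈ l₂, y = 0 := by
      intro y hy
      have hWxy : WeakBelow x₀ y :=
        List.rel_of_pairwise_cons (List.pairwise_append.mp hWl.1).2.1 hy
      obtain ⟨s', hs', hxs'⟩ := hWxy.below_one
      rw [one_mul, hx₀abs] at hxs'
      by_contra hy0
      have h1 : (2 : ℚ) ^ s' ≤ |y| := hs'.two_zpow_le_abs hy0
      have h2 : |y| ≤ (2 : ℚ) ^ (v - 1) := by
        rcases hsmall y (by simp [hy]) with h | h
        · exact h.le
        · exact h.le
      linarith
    -- before `x₀` everything lies below `2^(v-2)` (no component is adjacent to two others)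
    have hl₁ : ∀ y ∈ l₁, |y| < (2 : ℚ) ^ (v - 2) := by
      intro y hy
      have hsub : [y, x₀, a].Sublist (l₁ ++ x₀ :: l₂ ++ [a]) :=
        ((List.singleton_sublist.mpr hy).append
          (List.cons_sublist_cons.mpr (List.nil_sublist l₂))).append (List.Sublist.refl [a])
      have hW3 : IsWeakExpansion [y, x₀, a] := hW.sublist hsub
      have hND : NoDouble y x₀ a :=
        List.rel_of_pairwise_cons (List.triplewise_cons.mp hW3.2).1 (by simp)
      rcases hND with ⟨s', hs', hys'⟩ | ⟨s', hs', hxs'⟩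
      · have hx₀G : OnGrid (v - 1) x₀ := by
          rcases (abs_eq h2v1.le).mp hx₀abs with h | h
          · rw [h]; exact OnGrid.two_zpow le_rfl
          · rw [h]; exact (OnGrid.two_zpow le_rfl).neg
        have hs'v : s' ≤ v - 1 := by
          by_contra hlt
          rw [not_le] at hlt
          have := hs'.two_zpow_le_abs hx₀0
          rw [hx₀abs] at this
          have : (2 : ℚ) ^ (v - 1) < (2 : ℚ) ^ s' := zpow_lt_zpow_right₀ (by norm_num) hlt
          linarith
        have : (2 : ℚ) ^ s' ≤ (2 : ℚ) ^ (v - 1) := zpow_le_zpow_right₀ (by norm_num) hs'v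
        linarith
      · exfalso
        rw [hav] at hs'
        have : (2 : ℚ) ^ s' ≤ (2 : ℚ) ^ v :=
          zpow_le_zpow_right₀ (by norm_num) (OnGrid.le_of_odd hMo hs')
        rw [hx₀abs] at hxs'
        linarith
    have hE₁ : IsExpansion 1 l₁ := (List.pairwise_append.mp hEl).1
    have hsum₁ : |l₁.sum| < (2 : ℚ) ^ (v - 2) := abs_sum_lt_two_zpow_of_isExpansion hF₁ hE₁ hl₁
    -- the sum and the running value only see `l₁ ++ [x₀]`
    have hS : (l₁ ++ x₀ :: l₂).sum = l₁.sum + x₀ := by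
      rw [List.sum_append, List.sum_cons, List.sum_eq_zero hl₂, add_zero]
    have hQeq : estimate fl (l₁ ++ x₀ :: l₂) = estimate fl (l₁ ++ [x₀]) := by
      rw [show l₁ ++ x₀ :: l₂ = (l₁ ++ [x₀]) ++ l₂ by simp]
      exact estimate_append_of_forall_eq_zero hfl (by simp)
        (fun y hy => by
          rcases List.mem_append.mp hy with h | h
          · exact hF₁ y h
          · rw [List.mem_singleton.mp h]; exact hFx₀) hl₂
    rw [hS, hQeq]
    -- `a = 2x₀` (same signs) or `a = -2x₀` (opposite signs)
    have ha2 : |a| = |2 * x₀| := by rw [abs_mul, abs_two, hx₀abs, ha1, e1]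
    rcases abs_eq_abs.mp ha2 with hax | hax
    · -- same signs: `|Σ| ≥ 3·2^(v-1) − 2^(v-2) > 2^v`
      have hsub : (l₁ ++ [x₀]).Sublist (l₁ ++ x₀ :: l₂) := by simp
      have hF' : ∀ y ∈ l₁ ++ [x₀], IsFloat p emin y := fun y hy => hFl y (hsub.subset hy)
      have hE' : IsExpansion 1 (l₁ ++ [x₀]) := hEl.sublist hsub
      have hv' : ∀ y ∈ l₁ ++ [x₀], |y| < (2 : ℚ) ^ v := fun y hy => hv y (hsub.subset hy)
      have hS' : (l₁ ++ [x₀]).sum = l₁.sum + x₀ := by simp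
      have hbig : (2 : ℚ) ^ v ≤ |l₁.sum + x₀ + a| := by
        rw [hax]
        have h3 : |3 * x₀| - |l₁.sum| ≤ |l₁.sum + x₀ + 2 * x₀| := by
          have := abs_sub_abs_le_abs_sub (3 * x₀) (-l₁.sum)
          rw [abs_neg, sub_neg_eq_add] at this
          calc |3 * x₀| - |l₁.sum| ≤ |3 * x₀ + l₁.sum| := this
            _ = |l₁.sum + x₀ + 2 * x₀| := by congr 1; ring
        rw [abs_mul, hx₀abs, abs_of_pos (by norm_num : (0 : ℚ) < 3)] at h3
        linarith
      have := (abs_estimate_step_le_two_add_u hp1 hfl hF' hE' hFa hv' (by rwa [hS'])).trans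
        (h238 _)
      rwa [hS'] at this
    -- opposite signs: `a = -2x₀`, `Σ = l₁.sum − x₀`, `|Σ| ≥ 2^(v-1) − |l₁.sum| > 2^(v-2)`
    have hxa : x₀ + a = -x₀ := by rw [hax]; ring
    have hSlo2 : (2 : ℚ) ^ (v - 1) - |l₁.sum| ≤ |l₁.sum + x₀ + a| := by
      calc (2 : ℚ) ^ (v - 1) - |l₁.sum| = |x₀| - |l₁.sum| := by rw [hx₀abs]
        _ ≤ |x₀ - l₁.sum| := abs_sub_abs_le_abs_sub x₀ l₁.sum
        _ = |l₁.sum + x₀ + a| := by rw [add_assoc, hxa, abs_sub_comm]; congr 1; ring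
    by_cases hl₁0 : l₁ = []
    · -- `estimate [x₀] ⊕ a = fl (−x₀) = −x₀ = Σ`
      subst hl₁0
      rw [show estimate fl ([] ++ [x₀]) = x₀ from rfl, List.sum_nil, zero_add, hxa,
        fl_eq_self hfl hFx₀.neg, sub_self, abs_zero]
      exact mul_nonneg (mul_nonneg (by norm_num) hu0) (abs_nonneg _)
    rw [estimate_append_singleton fl hl₁0]
    -- notation: `Q₁ = estimate l₁`, `T = Q₁ + x₀`, `Q = fl T`, `R = Q + a`
    have hQ₁F : IsFloat p emin (estimate fl l₁) := isFloat_estimate hfl hF₁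
    have hQ₁ : |estimate fl l₁| ≤ (2 : ℚ) ^ (v - 2) := abs_estimate_le_two_zpow hp1 hfl hF₁ hE₁ hl₁
    have hW₁ : IsWeakExpansion l₁ := hWl.sublist (List.sublist_append_left l₁ (x₀ :: l₂))
    have hε₁ : |estimate fl l₁ - l₁.sum| ≤ unitRoundoff p * (2 : ℚ) ^ (v - 2) :=
      abs_estimate_sub_sum_le_of_isExpansion hp1 hfl hF₁ hE₁ hl₁
    -- the coupled invariant: `|Q₁ − Σ l₁| + (5/2)u|Σ l₁| ≤ 3u·2^(v-2)`
    have hIH₁ := abs_estimate_sub_sum_add_le_of_isWeakExpansion hp1 hfl hF₁ hW₁ hl₁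
    have hTG : OnGrid emin (estimate fl l₁ + x₀) :=
      (OnGrid.of_isFloat hQ₁F).add (OnGrid.of_isFloat hFx₀)
    have hQF' : IsFloat p emin (fl (estimate fl l₁ + x₀)) := (hfl _).1
    have hRG : OnGrid emin (fl (estimate fl l₁ + x₀) + a) :=
      (OnGrid.of_isFloat hQF').add (OnGrid.of_isFloat hFa)
    have hTv : |estimate fl l₁ + x₀| ≤ (2 : ℚ) ^ v := by
      have := abs_add_le (estimate fl l₁) x₀
      rw [hx₀abs] at this
      linarith
    -- sign bookkeeping: `T` has the sign of `x₀`, and so has `Q = fl T` (weakly)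
    have hTpos : 0 < x₀ → (2 : ℚ) ^ (v - 2) ≤ estimate fl l₁ + x₀ := fun h => by
      rw [abs_of_pos h] at hx₀abs
      obtain ⟨h1, -⟩ := abs_le.mp hQ₁
      linarith
    have hTneg : x₀ < 0 → estimate fl l₁ + x₀ ≤ -(2 : ℚ) ^ (v - 2) := fun h => by
      rw [abs_of_neg h] at hx₀abs
      obtain ⟨-, h2⟩ := abs_le.mp hQ₁
      linarith
    have hQpos : 0 < x₀ → 0 ≤ fl (estimate fl l₁ + x₀) := fun h =>
      fl_nonneg hfl (h2v2.le.trans (hTpos h))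
    have hQneg : x₀ < 0 → fl (estimate fl l₁ + x₀) ≤ 0 := fun h =>
      fl_le_of_le hfl (isFloat_zero p emin) ((hTneg h).trans (by linarith))
    obtain ⟨hε1, hε2⟩ := abs_le.mp hε₁
    have key : fl (fl (estimate fl l₁ + x₀) + a) - (l₁.sum + x₀ + a) =
        (fl (fl (estimate fl l₁ + x₀) + a) - (fl (estimate fl l₁ + x₀) + a)) +
          (fl (estimate fl l₁ + x₀) - (estimate fl l₁ + x₀)) + (estimate fl l₁ - l₁.sum) := by
      ring
    by_cases hT : |estimate fl l₁ + x₀| ≤ (2 : ℚ) ^ (v - 1)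
    · -- small `T`: `|Q| ≤ 2^(v-1)`, `|R| ≤ 2^v`, and `|Σ| ≥ 2^(v-1) − u·2^(v-2)`
      have hδ₂ := abs_fl_sub_le_half_u_two_zpow hp1 hfl hTG hT
      have hQle : |fl (estimate fl l₁ + x₀)| ≤ (2 : ℚ) ^ (v - 1) :=
        abs_fl_le_of_abs_le hfl (isFloat_two_zpow hp1 hev1) hT
      obtain ⟨hQ1, hQ2⟩ := abs_le.mp hQle
      obtain ⟨hT1, hT2⟩ := abs_le.mp hT
      have hR : |fl (estimate fl l₁ + x₀) + a| ≤ (2 : ℚ) ^ v := by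
        rw [abs_le, hax]
        rcases lt_or_gt_of_ne hx₀0 with h | h
        · rw [abs_of_neg h] at hx₀abs
          have := hQneg h
          constructor <;> linarith
        · rw [abs_of_pos h] at hx₀abs
          have := hQpos h
          constructor <;> linarith
      have hδ₃ := abs_fl_sub_le_half_u_two_zpow hp1 hfl hRG hR
      have hSlo : (2 : ℚ) ^ (v - 1) - unitRoundoff p * (2 : ℚ) ^ (v - 2) ≤ |l₁.sum + x₀ + a| := by
        rw [hax, le_abs]
        rcases lt_or_gt_of_ne hx₀0 with h | h
        · rw [abs_of_neg h] at hx₀abs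
          have := hTneg h
          left; linarith
        · rw [abs_of_pos h] at hx₀abs
          have := hTpos h
          right; linarith
      have hX : 0 ≤ unitRoundoff p * (2 : ℚ) ^ (v - 2) * (1 - 5 / 2 * unitRoundoff p) :=
        mul_nonneg (mul_nonneg hu0 h2v2.le) (by linarith)
      have h3S := mul_le_mul_of_nonneg_left hSlo
        (mul_nonneg (by norm_num) hu0 : (0 : ℚ) ≤ 5 / 2 * unitRoundoff p)
      rw [key]
      calc _ ≤ |fl (fl (estimate fl l₁ + x₀) + a) - (fl (estimate fl l₁ + x₀) + a)| +
            |fl (estimate fl l₁ + x₀) - (estimate fl l₁ + x₀)| + |estimate fl l₁ - l₁.sum| :=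
          abs_add_three _ _ _
        _ ≤ unitRoundoff p / 2 * (2 : ℚ) ^ v + unitRoundoff p / 2 * (2 : ℚ) ^ (v - 1) +
            unitRoundoff p * (2 : ℚ) ^ (v - 2) := add_le_add (add_le_add hδ₃ hδ₂) hε₁
        _ ≤ 5 / 2 * unitRoundoff p * |l₁.sum + x₀ + a| := by
          rw [e1, e2] at *; linarith
    · -- large `T`: `2^(v-1) ≤ |Q| ≤ 2^v`, so `R = Q + a` is EXACT (`|R| ≤ 2^(v-1)`)
      rw [not_le] at hT
      have hδ₂ := abs_fl_sub_le_half_u_two_zpow hp1 hfl hTG hTv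
      have hQge : (2 : ℚ) ^ (v - 1) ≤ |fl (estimate fl l₁ + x₀)| := by
        have := abs_le_abs_fl hfl (isFloat_two_zpow hp1 hev1) (t := estimate fl l₁ + x₀)
          (by rw [abs_of_pos h2v1]; exact hT.le)
        rwa [abs_of_pos h2v1] at this
      have hQle : |fl (estimate fl l₁ + x₀)| ≤ (2 : ℚ) ^ v :=
        abs_fl_le_of_abs_le hfl (isFloat_two_zpow hp1 hev) hTv
      have hRlt : |fl (estimate fl l₁ + x₀) + a| < (2 : ℚ) ^ v := by
        rw [abs_lt, hax]
        rcases lt_or_gt_of_ne hx₀0 with h | h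
        · rw [abs_of_neg h] at hx₀abs
          rw [abs_of_nonpos (hQneg h)] at hQge hQle
          constructor <;> linarith
        · rw [abs_of_pos h] at hx₀abs
          rw [abs_of_nonneg (hQpos h)] at hQge hQle
          constructor <;> linarith
      have hRF : IsFloat p emin (fl (estimate fl l₁ + x₀) + a) :=
        isFloat_add_of_two_zpow_le_abs hQF' hev hQge ⟨M, hav⟩ hRlt
      rw [key, fl_eq_self hfl hRF, sub_self, zero_add]
      have h52S := mul_le_mul_of_nonneg_left hSlo2
        (mul_nonneg (by norm_num) hu0 : (0 : ℚ) ≤ 5 / 2 * unitRoundoff p)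
      calc _ ≤ |fl (estimate fl l₁ + x₀) - (estimate fl l₁ + x₀)| + |estimate fl l₁ - l₁.sum| :=
          abs_add_le _ _
        _ ≤ 5 / 2 * unitRoundoff p * |l₁.sum + x₀ + a| := by
          rw [e1, e2] at *
          linarith

/-- **`|estimate − Σ| ≤ 3u·|Σ|` ON WEAKLY NONOVERLAPPING EXPANSIONS** (`p ≥ 2`): the rounder
form of `abs_estimate_sub_sum_le_sharp_of_isWeakExpansion` consumed by the stage-B/C files. -/
theorem abs_estimate_sub_sum_le_of_isWeakExpansion (hp : 2 ≤ p) (hfl : IsRoundNearest p emin fl) :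
    ∀ {l : List ℚ}, (∀ x ∈ l, IsFloat p emin x) → IsWeakExpansion l →
      |estimate fl l - l.sum| ≤ 3 * unitRoundoff p * |l.sum| := by
  intro l hF hW
  have hu0 : 0 ≤ unitRoundoff p := by unfold unitRoundoff; positivity
  exact (abs_estimate_sub_sum_le_sharp_of_isWeakExpansion hp hfl hF hW).trans
    (mul_le_mul_of_nonneg_right (by linarith) (abs_nonneg _))

/-- **COROLLARY: a two-sided enclosure of the true sum by the computed estimate** (`p ≥ 2`):
`(1 − 3u)·|Σ| ≤ |estimate| ≤ (1 + 3u)·|Σ|`. -/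
theorem abs_estimate_bounds_of_isWeakExpansion (hp : 2 ≤ p) (hfl : IsRoundNearest p emin fl)
    {l : List ℚ} (hF : ∀ x ∈ l, IsFloat p emin x) (hW : IsWeakExpansion l) :
    (1 - 3 * unitRoundoff p) * |l.sum| ≤ |estimate fl l| ∧
      |estimate fl l| ≤ (1 + 3 * unitRoundoff p) * |l.sum| := by
  have h := abs_estimate_sub_sum_le_of_isWeakExpansion hp hfl hF hW
  have h1 := abs_sub_abs_le_abs_sub (estimate fl l) l.sum
  have h2 := abs_sub_abs_le_abs_sub l.sum (estimate fl l)
  rw [abs_sub_comm] at h2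
  constructor <;> linarith

end Summit.Ventures.CertifiedArithmetic.Expansions
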